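import Summits.ValiantsHypothesis.ValiantsHypothesis.Theorems.BarrierLeverChowHitsPartitionMinorsRStarvedTheoremA
import Summits.ValiantsHypothesis.ValiantsHypothesis.Theorems.BarrierLeverChowHitsPartitionMinorsRBiStar
import Summits.ValiantsHypothesis.ValiantsHypothesis.Theorems.BarrierLeverChowHitsPartitionMinorsRNoStarGlue

/-!
# Route BarrierLever — item `ChowHitsPartitionMinorsR` (stmt-ValiantsHypothesis-21882):
# THEOREM A′ IN DEVICE SHAPE — the predicate `IsStarvedPair`, its arrow at every budget `M ≥ h + C(h,2)`,
# and the residual nodes «… and not starved» (registry v4 texts + unconditional glue)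

Helper file (`--supports stmt-ValiantsHypothesis-21882`; cell valiant-natproofs, rung V4, 𝒟-side support item of route
BarrierLever; prover seat val-np-p5 gen 32; planner RULING R69(c), STATUS l.1926). Closes NO item.

WHY. THEOREM A′ (`ChowStarvedDesign.chowHits_of_starved`, p727261) hits every STARVED pair — rows `u` = all subsets of
size `≤ 2` of `Fin h`; columns `w` injective, face-closed, of size `≤ 3`; a block `O ⊆ Fin h` such that every 3-column
avoids `O` and the pairs that are not columns are exactly the pairs `{α j, β j} ⊆ O` matched injectively with the
3-columns `j` — by the `h + #(3-columns)` explicit affine forms `{1 + x_a + y_a}_a ∪ {1 + x_{α j} + x_{β j} + Σ_{c ∈ w j} y_c}_j`.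
This class contains every layout on which all `h + h`-form designs die (`ChowStarvedPairs.exists_starvedPair`, p722854).
RULING R69(c) asks for the theorem IN DEVICE SHAPE, exactly like the x-star (p714438/p716670) and bi-star (p717689)
devices, so that the registered residual nodes of line `affine_lower` (registry v3a:
`ChowNoStar.Stmt.stub_thickPairsChowRNoBiStar` / `ChowNoStar.Stmt.stub_thickLowerSetsChowRNoBiStar`) can be NARROWED by
«not a starved pair (either way round)». This file provides:

* `ChowStarvedDesign.IsStarvedPair u w` — the hypotheses of `chowHits_of_starved` VERBATIM, with `O, α, β` bound
  existentially;
* `ChowStarvedDesign.card_threeCols_le_choose` — under the matching hypotheses the number of 3-columns is at most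
  `C(|O|, 2) ≤ C(h, 2)` (the map `j ↦ {α j, β j}` is injective into the 2-subsets of `O`);
* `ChowStarvedDesign.chowHits_of_isStarvedPair` — THE ARROW: a starved pair is hit by `M` affine forms for EVERY
  `M ≥ h + C(h, 2)` (THEOREM A′ + padding `ChowNoStar.chowHits_mono`); `chowHits_of_isStarvedPair_swap` — if the SWAPPED
  layout `(w, u)` is starved, `(u, w)` is hit as well (`ChowFacePrivate.chow_hit_swap_fin`);
* node texts `ChowNoStar.Stmt.stub_thickPairsChowRNoStarved`, `ChowNoStar.Stmt.stub_thickLowerSetsChowRNoStarved` := the v3a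
  texts VERBATIM with the two further hypotheses `¬ IsStarvedPair u w → ¬ IsStarvedPair w u →` inserted before the
  conclusion;
* UNCONDITIONAL glue `ChowNoStar.stub_thickPairsChowRNoBiStar_of_noStarved` (no threshold shift: `h + C(h,2) ≤ h·h` for
  every `h`) and `ChowNoStar.stub_thickLowerSetsChowRNoBiStar_of_noStarved` (threshold `max h₀ 5`: the lower-set budget
  `m + 2h ≤ h·h` with `m = h + C(h,2)` needs `h ≥ 5`), and the compositions BY NAME of each narrowed node into
  `Theses.BarrierLever.ChowHitsPartitionMinorsR` through the v3 ⟹ v2 ⟹ v1 ⟹ item chain (p717689, p720686, p716670).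

BUDGET ARITHMETIC. `h + C(h,2) = (h² + h)/2`; thick-pairs budget `h·h` holds for all `h`; lower-set budget `h·h − 2h`
holds iff `h ≥ 5`. Starvation lower bound on the class ≈ `h²/8` (memo REFUTATION-20195-valnp2-g9.md §2), so the device
is cost-optimal up to the constant.

WHAT THIS IS NOT: item 21882 (all layouts) is NOT proved — the narrowed nodes remain OPEN; nothing on crux
stmt-ValiantsHypothesis-14610 or on `VP` versus `VNP`.
-/

set_option linter.dupNamespace false

open Finset MvPolynomial

noncomputable section

namespace Summit.ValiantsHypothesis.ValiantsHypothesis.Theorems.BarrierLever.ChowStarvedDesign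

variable {h r : ℕ}

/-! ## 1. The starved class as a predicate -/

/-- **`IsStarvedPair u w`: the layout `(u, w)` is a STARVED PAIR** — the hypotheses of THEOREM A′
(`chowHits_of_starved`, p727261) VERBATIM, with the block `O` and the matching `α, β` bound existentially:
columns of size `≤ 3`; the rows cover all sets of size `≤ 2` and have size `≤ 2`; `w, u` injective; no column is a
matched pair `{α j, β j}`; the matching is injective; `α j, β j ∈ O`, `α j ≠ β j`; every 3-column avoids `O`; every
pair that is not a column is matched; the column family is face-closed. -/
def IsStarvedPair (u w : Fin r → Finset (Fin h)) : Prop :=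
  ∃ (O : Finset (Fin h)) (α β : {j : Fin r // (w j).card = 3} → Fin h),
    (∀ k, (w k).card ≤ 3) ∧ (∀ U : Finset (Fin h), U.card ≤ 2 → ∃ i, u i = U) ∧
    Function.Injective w ∧ Function.Injective u ∧
    (∀ j : {j : Fin r // (w j).card = 3}, ∀ k, w k ≠ {α j, β j}) ∧
    (∀ j j' : {j : Fin r // (w j).card = 3}, ({α j, β j} : Finset (Fin h)) = {α j', β j'} → j = j') ∧
    (∀ j, α j ∈ O) ∧ (∀ j, β j ∈ O) ∧ (∀ j, α j ≠ β j) ∧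
    (∀ j : {j : Fin r // (w j).card = 3}, ∀ c ∈ w j.1, c ∉ O) ∧
    (∀ a b : Fin h, a ≠ b → (∀ k, w k ≠ {a, b}) →
      ∃ j : {j : Fin r // (w j).card = 3}, ({α j, β j} : Finset (Fin h)) = {a, b}) ∧
    (∀ i, (u i).card ≤ 2) ∧
    (∀ j T, T ⊆ w j → ∃ k, w k = T)

/-! ## 2. Counting the 3-columns -/

section Count

variable (w : Fin r → Finset (Fin h)) (O : Finset (Fin h)) (α β : {j : Fin r // (w j).card = 3} → Fin h)
  (hinjE : ∀ j j' : {j : Fin r // (w j).card = 3}, ({α j, β j} : Finset (Fin h)) = {α j', β j'} → j = j')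
  (hα : ∀ j, α j ∈ O) (hβ : ∀ j, β j ∈ O) (hαβ : ∀ j, α j ≠ β j)

include hinjE hα hβ hαβ in
/-- **The number of 3-columns of a starved pair is at most `C(|O|, 2)`**: `j ↦ {α j, β j}` injects the 3-columns into
the 2-subsets of `O`. -/
theorem card_threeCols_le_choose_card :
    Fintype.card {j : Fin r // (w j).card = 3} ≤ O.card.choose 2 := by
  classical
  let f : {j : Fin r // (w j).card = 3} → {U : Finset (Fin h) // U ∈ O.powersetCard 2} := fun j =>
    ⟨{α j, β j}, by
      rw [Finset.mem_powersetCard]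
      refine ⟨?_, Finset.card_pair (hαβ j)⟩
      intro x hx
      simp only [Finset.mem_insert, Finset.mem_singleton] at hx
      rcases hx with rfl | rfl
      · exact hα j
      · exact hβ j⟩
  have hf : Function.Injective f := fun j j' e => hinjE j j' (by
    simpa only [f, Subtype.mk.injEq] using e)
  have := Fintype.card_le_of_injective f hf
  rwa [Fintype.card_coe, Finset.card_powersetCard] at this

include hinjE hα hβ hαβ in
/-- **… hence at most `C(h, 2)`.** -/
theorem card_threeCols_le_choose :
    Fintype.card {j : Fin r // (w j).card = 3} ≤ h.choose 2 := by
  refine (card_threeCols_le_choose_card w O α β hinjE hα hβ hαβ).trans ?_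
  have hO : O.card ≤ h := by
    simpa only [Fintype.card_fin] using Finset.card_le_univ O
  exact Nat.choose_le_choose 2 hO

end Count

/-! ## 3. The arrow -/

/-- **STARVED ARROW (THEOREM A′ in device shape).** A starved pair is hit by a product of `M` affine forms for every
`M ≥ h + C(h, 2)`: the `h + #(3-columns) ≤ h + C(h,2)` forms of `chowHits_of_starved`, padded with constant factors
(`ChowNoStar.chowHits_mono`). -/
theorem chowHits_of_isStarvedPair {M : ℕ} (hM : h + h.choose 2 ≤ M) (u w : Fin r → Finset (Fin h))
    (hS : IsStarvedPair u w) :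
    ∃ ℓ : Fin M → MvPolynomial (Fin (h + h)) ℂ, (∀ k, (ℓ k).totalDegree ≤ 1) ∧
      (Matrix.of fun i j : Fin r => MvPolynomial.coeff (∑ a ∈ u i, Finsupp.single (Fin.castAdd h a) 1 +
          ∑ c ∈ w j, Finsupp.single (Fin.natAdd h c) 1) (∏ k, ℓ k)).det ≠ 0 := by
  obtain ⟨O, α, β, hw3, hucov, hw, hu, hne, hinjE, hα, hβ, hαβ, hK, hsurj, hu2, hloww⟩ := hS
  have hc : h + Fintype.card {j : Fin r // (w j).card = 3} ≤ M :=
    le_trans (Nat.add_le_add_left (card_threeCols_le_choose w O α β hinjE hα hβ hαβ) h) hM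
  exact ChowNoStar.chowHits_mono hc u w
    (chowHits_of_starved w O α β u hw3 hucov hw hu hne hinjE hα hβ hαβ hK hsurj hu2 hloww)

/-- **STARVED ARROW, swapped.** If the SWAPPED layout `(w, u)` is a starved pair (columns = all sets of size `≤ 2`,
rows starved), then `(u, w)` is hit by `M` affine forms for every `M ≥ h + C(h, 2)` (the arrow for `(w, u)` and the
`x ↔ y` flip `ChowFacePrivate.chow_hit_swap_fin`). -/
theorem chowHits_of_isStarvedPair_swap {M : ℕ} (hM : h + h.choose 2 ≤ M) (u w : Fin r → Finset (Fin h))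
    (hS : IsStarvedPair w u) :
    ∃ ℓ : Fin M → MvPolynomial (Fin (h + h)) ℂ, (∀ k, (ℓ k).totalDegree ≤ 1) ∧
      (Matrix.of fun i j : Fin r => MvPolynomial.coeff (∑ a ∈ u i, Finsupp.single (Fin.castAdd h a) 1 +
          ∑ c ∈ w j, Finsupp.single (Fin.natAdd h c) 1) (∏ k, ℓ k)).det ≠ 0 :=
  ChowFacePrivate.chow_hit_swap_fin u w (chowHits_of_isStarvedPair hM w u hS)

/-! ## 4. Budget arithmetic -/

/-- **Thick-pairs budget**: `h + C(h,2) ≤ h·h` for every `h` (from `2·C(h,2) + h = h·h`, the identity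
`Literature.Computability.Complexity.two_mul_choose_two_add`, re-derived inline to keep the import cone small). -/
theorem add_choose_two_le_sq (h : ℕ) : h + h.choose 2 ≤ h * h := by
  have key : 2 * h.choose 2 + h = h * h := by
    rcases h with _ | n
    · simp
    · have e := Nat.add_one_mul_choose_eq n 1
      rw [Nat.choose_one_right] at e
      nlinarith [e]
  nlinarith [key, Nat.zero_le (h.choose 2)]

/-- **Lower-set budget**: `(h + C(h,2)) + 2h ≤ h·h` as soon as `h ≥ 5`. -/
theorem add_choose_two_add_le_sq {h : ℕ} (h5 : 5 ≤ h) : (h + h.choose 2) + 2 * h ≤ h * h := by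
  have key : 2 * h.choose 2 + h = h * h := by
    rcases h with _ | n
    · simp
    · have e := Nat.add_one_mul_choose_eq n 1
      rw [Nat.choose_one_right] at e
      nlinarith [e]
  nlinarith [key, Nat.zero_le (h.choose 2)]

end Summit.ValiantsHypothesis.ValiantsHypothesis.Theorems.BarrierLever.ChowStarvedDesign

/-! ## 5. The residual nodes «… and not starved» (registry v4 texts) and the unconditional glue -/

namespace Summit.ValiantsHypothesis.ValiantsHypothesis.Theorems.BarrierLever.ChowNoStar

open Summit.ValiantsHypothesis.ValiantsHypothesis.Theorems.BarrierLever.ChowStarvedDesign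
  (IsStarvedPair chowHits_of_isStarvedPair chowHits_of_isStarvedPair_swap add_choose_two_le_sq
    add_choose_two_add_le_sq)

variable {h r : ℕ}

/-- **NARROWED NODE (v4, R69(c)): THICK PAIRS THAT ARE NEITHER STAR-, NOR BI-STAR-CERTIFIABLE, NOR STARVED (either way
round)** — `Stmt.stub_thickPairsChowRNoBiStar` (p717689, registry v3a VERBATIM) with the two further hypotheses
`¬ IsStarvedPair u w` and `¬ IsStarvedPair w u`. WEAKER than v3a, UNCONDITIONALLY
(`stub_thickPairsChowRNoBiStar_of_noStarved`). KNOWN MEMBERS: none by name — every layout on which all `h + h`-form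
designs are known to die is a starved pair. WHY IT MIGHT FAIL: a thick, doubly non-star, non-bi-star, non-starved
layout (e.g. rows = all `≤ 2`-sets against a faces-`≤ 3` lower column family whose non-column pairs CROSS the block
structure, or higher-dimensional analogues: rows = all `≤ 3`-sets) on which every product of `h·h` affine forms has
vanishing partition minor. -/
def Stmt.stub_thickPairsChowRNoStarved : Prop :=
  ∃ h₀ : ℕ, ∀ h : ℕ, h₀ ≤ h → ∀ (r : ℕ) (u w : Fin r → Finset (Fin h)),
    Function.Injective u → Function.Injective w →
    h * h < (∑ i, (u i).card) + h → h * h < (∑ j, (w j).card) + h →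
    ¬ IsXStarCertifiable u w → ¬ IsXStarCertifiable w u → ¬ IsBiStarCertifiable u w →
    ¬ Summit.ValiantsHypothesis.ValiantsHypothesis.Theorems.BarrierLever.ChowStarvedDesign.IsStarvedPair u w →
    ¬ Summit.ValiantsHypothesis.ValiantsHypothesis.Theorems.BarrierLever.ChowStarvedDesign.IsStarvedPair w u →
    ∃ ℓ : Fin (h * h) → MvPolynomial (Fin (h + h)) ℂ,
      (∀ k, (ℓ k).totalDegree ≤ 1) ∧
      (Matrix.of fun i j : Fin r => MvPolynomial.coeff
        (∑ a ∈ u i, Finsupp.single (Fin.castAdd h a) 1 +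
          ∑ c ∈ w j, Finsupp.single (Fin.natAdd h c) 1) (∏ k, ℓ k)).det ≠ 0

/-- **NARROWED NODE (v4, R69(c)): THICK LOWER-SET PAIRS THAT ARE NEITHER STAR-, NOR BI-STAR-CERTIFIABLE, NOR STARVED**
(budget `m + 2h ≤ h·h`) — `Stmt.stub_thickLowerSetsChowRNoBiStar` (p717689, registry v3a VERBATIM) with the two further
hypotheses `¬ IsStarvedPair v w'` and `¬ IsStarvedPair w' v`. WEAKER than v3a, UNCONDITIONALLY
(`stub_thickLowerSetsChowRNoBiStar_of_noStarved`, threshold `max h₀ 5`). -/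
def Stmt.stub_thickLowerSetsChowRNoStarved : Prop :=
  ∃ h₀ : ℕ, ∀ h : ℕ, h₀ ≤ h → ∀ (r : ℕ) (v w' : Fin r → Finset (Fin h)),
    Function.Injective v → Function.Injective w' →
    IsLowerSet (Set.range v) → IsLowerSet (Set.range w') →
    h * h < (∑ i, (v i).card) + 2 * h → h * h < (∑ j, (w' j).card) + 2 * h →
    ¬ IsXStarCertifiable v w' → ¬ IsXStarCertifiable w' v → ¬ IsBiStarCertifiable v w' →
    ¬ Summit.ValiantsHypothesis.ValiantsHypothesis.Theorems.BarrierLever.ChowStarvedDesign.IsStarvedPair v w' →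
    ¬ Summit.ValiantsHypothesis.ValiantsHypothesis.Theorems.BarrierLever.ChowStarvedDesign.IsStarvedPair w' v →
    ∃ m : ℕ, m + 2 * h ≤ h * h ∧ ∃ ℓ : Fin m → MvPolynomial (Fin (h + h)) ℂ,
      (∀ k, (ℓ k).totalDegree ≤ 1) ∧
      (Matrix.of fun i j : Fin r => MvPolynomial.coeff
        (∑ a ∈ v i, Finsupp.single (Fin.castAdd h a) 1 +
          ∑ c ∈ w' j, Finsupp.single (Fin.natAdd h c) 1) (∏ k, ℓ k)).det ≠ 0

/-- **GLUE (unconditional): «no starved» node ⟹ NoBiStar node, thick pairs** — starved pairs (either way round) are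
hit by `h + C(h,2) ≤ h·h` forms for EVERY `h` (`chowHits_of_isStarvedPair[_swap]` + `add_choose_two_le_sq`); no
threshold shift. -/
theorem stub_thickPairsChowRNoBiStar_of_noStarved (hN : Stmt.stub_thickPairsChowRNoStarved) :
    Stmt.stub_thickPairsChowRNoBiStar := by
  obtain ⟨h₀, hN⟩ := hN
  refine ⟨h₀, fun h hh r u w hu hw hU hW hX hY hB => ?_⟩
  by_cases hS : IsStarvedPair u w
  · exact chowHits_of_isStarvedPair (add_choose_two_le_sq h) u w hS
  by_cases hS' : IsStarvedPair w u
  · exact chowHits_of_isStarvedPair_swap (add_choose_two_le_sq h) u w hS'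
  exact hN h hh r u w hu hw hU hW hX hY hB hS hS'

/-- **GLUE (unconditional): «no starved» node ⟹ NoBiStar node, thick lower-set pairs** — starved pairs are hit by
`m = h + C(h,2)` forms and `m + 2h ≤ h·h` for `h ≥ 5` (threshold `max h₀ 5`). -/
theorem stub_thickLowerSetsChowRNoBiStar_of_noStarved (hN : Stmt.stub_thickLowerSetsChowRNoStarved) :
    Stmt.stub_thickLowerSetsChowRNoBiStar := by
  obtain ⟨h₀, hN⟩ := hN
  refine ⟨max h₀ 5, fun h hh r v w' hv hw hlv hlw hV hW hX hY hB => ?_⟩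
  have hh₀ : h₀ ≤ h := le_trans (le_max_left _ _) hh
  have h5 : 5 ≤ h := le_trans (le_max_right _ _) hh
  by_cases hS : IsStarvedPair v w'
  · exact ⟨h + h.choose 2, add_choose_two_add_le_sq h5, chowHits_of_isStarvedPair le_rfl v w' hS⟩
  by_cases hS' : IsStarvedPair w' v
  · exact ⟨h + h.choose 2, add_choose_two_add_le_sq h5, chowHits_of_isStarvedPair_swap le_rfl v w' hS'⟩
  exact hN h hh₀ r v w' hv hw hlv hlw hV hW hX hY hB hS hS'

/-! ## 6. Compositions into the item, BY NAME (v4 ⟹ v3 ⟹ v2 ⟹ v1 ⟹ item) -/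

/-- **THE ITEM FROM THE v4 THICK-PAIRS NODE**: `Stmt.stub_thickPairsChowRNoStarved` alone implies
`Theses.BarrierLever.ChowHitsPartitionMinorsR` (this file's glue, then p717689 `stub_thickPairsChowRNoStar_of_noBiStar`,
p720686 `stub_thickPairsChowR_of_noStar`, p716670 `chowHitsPartitionMinorsR_of_thickPairs`). -/
theorem chowHitsPartitionMinorsR_of_thickPairsNoStarved (hN : Stmt.stub_thickPairsChowRNoStarved) :
    Summit.ValiantsHypothesis.ValiantsHypothesis.Theses.BarrierLever.ChowHitsPartitionMinorsR :=
  chowHitsPartitionMinorsR_of_thickPairs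
    (stub_thickPairsChowR_of_noStar
      (stub_thickPairsChowRNoStar_of_noBiStar (stub_thickPairsChowRNoBiStar_of_noStarved hN)))

/-- **THE ITEM FROM THE v4 THICK LOWER-SET NODE**: `Stmt.stub_thickLowerSetsChowRNoStarved` alone implies
`Theses.BarrierLever.ChowHitsPartitionMinorsR` (glue, then p717689, p720686, p716670's lower-set composition). -/
theorem chowHitsPartitionMinorsR_of_thickLowerSetsNoStarved (hN : Stmt.stub_thickLowerSetsChowRNoStarved) :
    Summit.ValiantsHypothesis.ValiantsHypothesis.Theses.BarrierLever.ChowHitsPartitionMinorsR :=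
  chowHitsPartitionMinorsR_of_thickLowerSets
    (stub_thickLowerSetsChowR_of_noStar
      (stub_thickLowerSetsChowRNoStar_of_noBiStar (stub_thickLowerSetsChowRNoBiStar_of_noStarved hN)))

/-- sanity (kernel): the item implies the v4 thick-pairs node (a restriction of the item). -/
theorem stub_thickPairsChowRNoStarved_of_item
    (H : Summit.ValiantsHypothesis.ValiantsHypothesis.Theses.BarrierLever.ChowHitsPartitionMinorsR) :
    Stmt.stub_thickPairsChowRNoStarved := by
  obtain ⟨h₀, H⟩ := H
  exact ⟨h₀, fun h hh r u w hu hw _ _ _ _ _ _ _ => H h hh r u w hu hw⟩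

end Summit.ValiantsHypothesis.ValiantsHypothesis.Theorems.BarrierLever.ChowNoStar

end
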